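import Literature.NumberTheory.EllipticCurves.EisensteinValuesAtI
import Literature.NumberTheory.EllipticCurves.WeierstrassAdditionProofs
import Literature.NumberTheory.EllipticCurves.RealLatticePeriodDiscrProofs
import Literature.NumberTheory.EllipticCurves.WeierstrassZetaLegendre
import Literature.NumberTheory.EllipticCurves.NeronSigmaFunctionAnalyticProofs
import HarnessLib

/-!
# The Gaussian lattice `ℤi + ℤ`: quarter-period values of `℘`, `℘'`, `ζ` and the two
# Eisenstein–Kronecker numbers `E₁*(1/4)`, `E₁*((3+2i)/4)`

Topic `Literature/NumberTheory/EllipticCurves` (the complex-lattice cluster: `EisensteinValuesAtI`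
has `g₂(ℤi + ℤ) = Γ(1/4)⁸/(16π²)`, `℘(1/2) = Γ(1/4)⁴/(8π)`, `G₂(i) = π`; `WeierstrassAdditionProofs`
the addition and duplication theorems for `℘`, `ζ`; `WeierstrassZetaLegendre` Eisenstein's
formulae for the quasi-periods). Filed for the named fact
`Literature.NumberTheory.EllipticCurves.BirchSwinnertonDyer1965_L_one_two_ten` (the CM `L`-values
`L(E₂, 1) = β/(2√2)`, `L(E₁₀, 1) = 2β/√10` used in Tunnell's Theorem 3, `BSDAnalyticRankTunnellWaldspurgerProofs`)
and its odd companion `BirchSwinnertonDyer1965_L_one_one_three`: by Kronecker's limit formula in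
weight one, `L(E_n, 1)` for the congruent number curves `E_n : y² = x³ − n²x` is a finite
combination of values of `E₁*(z) = ζ(z) − π z̄` (`kroneckerE₁`) at division points of the
Gaussian lattice `Λ = ℤi + ℤ` (Birch–Swinnerton-Dyer, *Notes on elliptic curves II*, Crelle 218
(1965), §§1–3), and for `n = 1, 2` only the two primary quarter classes `1/4`, `(3+2i)/4` occur.
Everything here is **proved**; the only definition is `kroneckerE₁`.

With `Λ = ℤi + ℤ` (Mathlib `PeriodPair.ofUpperHalfPlane I`, periods `ω₁ = i`, `ω₂ = 1`),
`ϖ₀ = Γ(1/4)²/(2√(2π)) = ∫₁^∞ du/√(u³ − u)` (`= β = 2.62205…`, the real period of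
`y² = x³ − x`; `Literature.Analysis.SpecialFunctions.integral_Ioi_one_inv_sqrt_cube_sub_self`):

* symmetries: `℘(iz) = −℘(z)`, `℘'(iz) = i℘'(z)`, `ζ(iz) = −iζ(z)` (`iΛ = Λ`);
* quasi-periods: `ζ(z + 1) = ζ(z) + π`, `ζ(z + i) = ζ(z) − πi` (Eisenstein: `η = G₂(i) = π`,
  Legendre), `ζ(1/2) = π/2`, `ζ(i/2) = −πi/2`, `ζ((1+i)/2) = π(1−i)/2`;
* half-periods: `e₁ = ℘(1/2) = ϖ₀²`, `g₂ = 4ϖ₀⁴`, `e₃ = ℘((1+i)/2) = 0 = ℘'((1+i)/2)`;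
* **quarter-periods**: `℘(1/4) = (1 + √2)ϖ₀²` (duplication formula: `(p² − 2e₁p − e₁²)² = 0`,
  `p > e₁`), `℘'(1/4) = −2√2(1 + √2)ϖ₀³` (`℘' < 0` on `(0, 1/2)`),
  `℘''(1/4)/℘'(1/4) = −2(1 + √2)ϖ₀`, `ζ(1/4) = π/4 + (1 + √2)ϖ₀/2` (`ζ(2u)` formula),
  `℘((3+2i)/4) = (1 − √2)ϖ₀²`, `ζ((3+2i)/4) = 3π/4 − πi/2 + (1 − √2)ϖ₀/2` (addition theorems at
  `1/4 + (1+i)/2`);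
* `kroneckerE₁ z = ζ(z) − π z̄`: odd, `E₁*(iz) = −iE₁*(z)`, `Λ`-periodic, and
  **`E₁*(1/4) = (1 + √2)ϖ₀/2`, `E₁*((3+2i)/4) = (1 − √2)ϖ₀/2`**, so that
  `E₁*(1/4) + E₁*((3+2i)/4) = ϖ₀` (giving `L(E₁, 1) = β/4`) and
  `E₁*(1/4) − E₁*((3+2i)/4) = √2 ϖ₀` (giving `L(E₂, 1) = β/(2√2)`).

These are the classical lemniscatic division values (Abel, Eisenstein); e.g. `℘(ω/2) = e₁ + √((e₁−e₂)(e₁−e₃))`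
(Whittaker–Watson §20.33 Example 1) with `e₁, e₂, e₃ = ϖ₀², −ϖ₀², 0` gives `℘(1/4) = (1 + √2)ϖ₀²`.

## References

* E. T. Whittaker, G. N. Watson, *A Course of Modern Analysis*, 4th ed., §20.33 (quarter-period
  values), §20.41 (quasi-periodicity), §22.8 (lemniscate functions).
* A. Weil, *Elliptic Functions according to Eisenstein and Kronecker*, Springer 1976, Ch. VIII
  (`E₁*`, Kronecker's limit formulae).
* B. J. Birch, H. P. F. Swinnerton-Dyer, *Notes on elliptic curves. II*, J. reine angew. Math. 218
  (1965) 79–108, §§1–3 (finite formulae for `L_D(1)` of `y² = x³ − Dx`).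
-/

noncomputable section

open Complex PeriodPair Real Set Filter
open scoped Real Topology PeriodPair

namespace Literature.NumberTheory.EllipticCurves

namespace GaussianLattice

/-- The Gaussian period pair `(i, 1)` (lattice `ℤi + ℤ`), local notation. -/
local notation "Λᵢ" => PeriodPair.ofUpperHalfPlane UpperHalfPlane.I

/-- The lemniscatic constant `ϖ₀ = Γ(1/4)²/(2√(2π)) = ∫₁^∞ du/√(u³ − u) = 2.62205…/…`, local
notation. -/
local notation "ϖ₀" => (Real.Gamma (1 / 4) ^ 2 / (2 * Real.sqrt (2 * π)) : ℝ)

/-! ### Symmetries of `ℤi + ℤ`: `℘(iz) = −℘(z)`, `℘'(iz) = i℘'(z)`, `ζ(iz) = −iζ(z)` -/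

/-- `i(ℤi + ℤ) = ℤi + ℤ` as lattices. [folklore] -/
theorem mulLeft_I_lattice_eq : ((Λᵢ).mulLeft I I_ne_zero).lattice = (Λᵢ).lattice :=
  mulLeft_lattice_eq_of_mul_mem_lattice_iff I_ne_zero I_mul_mem_lattice_ofUpperHalfPlane_I_iff

/-- **`℘(iz) = −℘(z)`** for the Gaussian lattice (`℘_Λ(iz) = −℘_{iΛ}(z)` and `iΛ = Λ`).
[folklore] -/
theorem weierstrassP_I_mul (z : ℂ) : ℘[Λᵢ] (I * z) = -℘[Λᵢ] z := by
  rw [PeriodPair.weierstrassP_I_mul, weierstrassP_eq_of_lattice_eq mulLeft_I_lattice_eq]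

/-- **`℘'(iz) = i℘'(z)`** for the Gaussian lattice. [folklore] -/
theorem derivWeierstrassP_I_mul (z : ℂ) : ℘'[Λᵢ] (I * z) = I * ℘'[Λᵢ] z := by
  rw [PeriodPair.derivWeierstrassP_I_mul, derivWeierstrassP_eq_of_lattice_eq mulLeft_I_lattice_eq]

/-- `ζ` only depends on the lattice. [folklore] -/
theorem weierstrassZeta_eq_of_lattice_eq {L L' : PeriodPair} (h : L.lattice = L'.lattice) :
    L.weierstrassZeta = L'.weierstrassZeta := by
  ext z
  simp only [weierstrassZeta]
  exact (Equiv.subtypeEquivProp congr(($h : Set ℂ))).tsum_eq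
    fun l : L'.lattice ↦ (1 / (z - l) + 1 / (l : ℂ) + z / (l : ℂ) ^ 2)

/-- **`ζ(iz) = −iζ(z)`** for the Gaussian lattice (`ζ_{iΛ}(iz) = i⁻¹ζ_Λ(z)`,
`PeriodPair.weierstrassZeta_mulLeft`, and `iΛ = Λ`). [folklore] -/
theorem weierstrassZeta_I_mul (z : ℂ) :
    (Λᵢ).weierstrassZeta (I * z) = -I * (Λᵢ).weierstrassZeta z := by
  have h := (Λᵢ).weierstrassZeta_mulLeft I_ne_zero z
  rw [weierstrassZeta_eq_of_lattice_eq mulLeft_I_lattice_eq, Complex.inv_I] at h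
  exact h

/-! ### Quasi-periods: `ζ(z + 1) = ζ(z) + π`, `ζ(z + i) = ζ(z) − πi` -/

/-- The point `⟨i/1⟩` of `ℍ` is `UpperHalfPlane.I`. [folklore] -/
theorem upperHalfPlane_mk_I_div_one (h : 0 < ((Λᵢ).ω₁ / (Λᵢ).ω₂).im) :
    (⟨(Λᵢ).ω₁ / (Λᵢ).ω₂, h⟩ : UpperHalfPlane) = UpperHalfPlane.I := by
  apply UpperHalfPlane.ext
  simp [UpperHalfPlane.coe_I]

/-- The orientation hypothesis for the basis `(1, i)`: `Im(i/1) > 0`. [folklore] -/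
theorem im_ω₁_div_ω₂_pos : 0 < ((Λᵢ).ω₁ / (Λᵢ).ω₂).im := by
  simp [UpperHalfPlane.coe_I]

/-- **`ζ(z + 1) = ζ(z) + π`** for `ℤi + ℤ`: Eisenstein's `η = G₂(τ)/a` for the basis `(1, i)`
with `G₂(i) = π`. [folklore] -/
theorem weierstrassZeta_add_one (z : ℂ) :
    (Λᵢ).weierstrassZeta (z + 1) = (Λᵢ).weierstrassZeta z + π := by
  have h := weierstrassZeta_add_fst_sub _ (Λᵢ).coe_prodComm_latticeEquivProd_symm
    im_ω₁_div_ω₂_pos z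
  rw [upperHalfPlane_mk_I_div_one, ModularForms.G2_I] at h
  simp only [ofUpperHalfPlane_ω₂, div_one] at h
  linear_combination h

/-- **`ζ(z + i) = ζ(z) − πi`** for `ℤi + ℤ`: Eisenstein's second formula
`ζ(z + b) − ζ(z) = bG₂(τ)/a² − 2πi/a` for the basis `(1, i)`. [folklore] -/
theorem weierstrassZeta_add_I (z : ℂ) :
    (Λᵢ).weierstrassZeta (z + I) = (Λᵢ).weierstrassZeta z - π * I := by
  have h := weierstrassZeta_add_snd_sub _ (Λᵢ).coe_prodComm_latticeEquivProd_symm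
    im_ω₁_div_ω₂_pos z
  rw [upperHalfPlane_mk_I_div_one, ModularForms.G2_I] at h
  simp only [ofUpperHalfPlane_ω₂, ofUpperHalfPlane_ω₁, UpperHalfPlane.coe_I, div_one, one_pow]
    at h
  linear_combination h

/-- `ζ(z − 1) = ζ(z) − π`. [folklore] -/
theorem weierstrassZeta_sub_one (z : ℂ) :
    (Λᵢ).weierstrassZeta (z - 1) = (Λᵢ).weierstrassZeta z - π := by
  have := weierstrassZeta_add_one (z - 1)
  rw [sub_add_cancel] at this
  linear_combination -this

/-- **`ζ(1/2) = π/2`** (`= η/2` for the period `1`). [folklore] -/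
theorem weierstrassZeta_half : (Λᵢ).weierstrassZeta (1 / 2) = π / 2 := by
  have h := weierstrassZeta_add_one (-(1 / 2))
  rw [show -(1 / 2 : ℂ) + 1 = 1 / 2 by norm_num, weierstrassZeta_neg] at h
  linear_combination h / 2

/-- **`ζ(i/2) = −πi/2`**. [folklore] -/
theorem weierstrassZeta_I_half : (Λᵢ).weierstrassZeta (I / 2) = -(π * I / 2) := by
  have h := weierstrassZeta_add_I (-(I / 2))
  rw [show -(I / 2 : ℂ) + I = I / 2 by ring, weierstrassZeta_neg] at h
  linear_combination h / 2

/-- **`ζ((1+i)/2) = π(1 − i)/2`** (`= (η₁ + η₂)/2`). [folklore] -/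
theorem weierstrassZeta_one_add_I_half :
    (Λᵢ).weierstrassZeta ((1 + I) / 2) = π * (1 - I) / 2 := by
  have h1 := weierstrassZeta_add_one (-((1 + I) / 2))
  have h2 := weierstrassZeta_add_I ((1 - I) / 2)
  rw [show -((1 + I) / 2 : ℂ) + 1 = (1 - I) / 2 by ring, weierstrassZeta_neg] at h1
  rw [show ((1 - I) / 2 : ℂ) + I = (1 + I) / 2 by ring] at h2
  linear_combination (h1 + h2) / 2

/-! ### Lattice membership -/

/-- A point of `ℤi + ℤ` has integer real part; so `x ∉ ℤi + ℤ` if `re x` is not an integer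
(for real `x` this is `ofReal_mem_lattice_iff`; used here for the non-real points `(1+i)/2`,
`(3+2i)/4`). [folklore] -/
theorem notMem_lattice_of_re {x : ℂ} (h : ∀ n : ℤ, (n : ℝ) ≠ x.re) : x ∉ (Λᵢ).lattice := by
  intro hx
  obtain ⟨m, n, hmn⟩ := mem_lattice_iff.mp hx
  apply h n
  have := congrArg Complex.re hmn
  simpa using this

/-- `1/4 ∉ ℤi + ℤ` (a real point of `ℤi + ℤ` is an integer, `ofReal_mem_lattice_iff`). [folklore] -/
theorem one_quarter_notMem : (1 / 4 : ℂ) ∉ (Λᵢ).lattice := by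
  rw [show (1 / 4 : ℂ) = ((1 / 4 : ℝ) : ℂ) by push_cast; ring, ofReal_mem_lattice_iff]
  rintro ⟨n, hn⟩
  have h4 : (4 * n : ℝ) = 1 := by linarith
  have : (4 * n : ℤ) = 1 := by exact_mod_cast h4
  omega

/-- `(1+i)/2 ∉ ℤi + ℤ`. [folklore] -/
theorem one_add_I_half_notMem : ((1 + I) / 2 : ℂ) ∉ (Λᵢ).lattice := by
  refine notMem_lattice_of_re fun n h ↦ ?_
  norm_num at h
  have h2 : (2 * n : ℝ) = 1 := by linarith
  have : (2 * n : ℤ) = 1 := by exact_mod_cast h2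
  omega

/-- `(3+2i)/4 ∉ ℤi + ℤ`. [folklore] -/
theorem three_add_two_I_quarter_notMem : ((3 + 2 * I) / 4 : ℂ) ∉ (Λᵢ).lattice := by
  refine notMem_lattice_of_re fun n h ↦ ?_
  norm_num at h
  have h4 : (4 * n : ℝ) = 3 := by linarith
  have : (4 * n : ℤ) = 3 := by exact_mod_cast h4
  omega

/-- `1 + i ∈ ℤi + ℤ`. [folklore] -/
theorem one_add_I_mem : (1 + I : ℂ) ∈ (Λᵢ).lattice :=
  mem_lattice_iff.mpr ⟨1, 1, by push_cast; ring⟩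

/-- `1 ∈ ℤi + ℤ`. [folklore] -/
theorem one_mem : (1 : ℂ) ∈ (Λᵢ).lattice :=
  mem_lattice_iff.mpr ⟨0, 1, by push_cast; ring⟩

/-! ### The third half-period `(1+i)/2`: `℘ = 0`, `℘' = 0` -/

/-- **`℘((1+i)/2) = 0`**: `℘(iz) = −℘(z)` and `i(1+i)/2 ≡ (1+i)/2 (mod Λ)`; so `e₃ = 0` is the
middle root of `4x³ − g₂x`. [folklore] -/
theorem weierstrassP_one_add_I_half : ℘[Λᵢ] ((1 + I) / 2) = 0 := by
  have h := weierstrassP_I_mul ((1 + I) / 2)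
  have hper := (Λᵢ).weierstrassP_sub_coe ((1 + I) / 2) ⟨1, one_mem⟩
  rw [show I * ((1 + I) / 2) = (1 + I) / 2 - 1 by linear_combination I_sq / 2] at h
  rw [Subtype.coe_mk] at hper
  rw [hper] at h
  linear_combination h / 2

/-- **`℘'((1+i)/2) = 0`** (`℘'` is odd and `Λ`-periodic, `2 · (1+i)/2 ∈ Λ`). [folklore] -/
theorem derivWeierstrassP_one_add_I_half : ℘'[Λᵢ] ((1 + I) / 2) = 0 := by
  have hper := (Λᵢ).derivWeierstrassP_sub_coe ((1 + I) / 2) ⟨1 + I, one_add_I_mem⟩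
  rw [Subtype.coe_mk, show (1 + I) / 2 - (1 + I) = -((1 + I) / 2) by ring,
    derivWeierstrassP_neg] at hper
  linear_combination -hper / 2


/-! ### The constant `ϖ₀`, `e₁ = ℘(1/2) = ϖ₀²` and `g₂ = 4ϖ₀⁴` -/

/-- `ϖ₀ > 0`. [folklore] -/
theorem varpi_pos : 0 < ϖ₀ := by
  have := Real.Gamma_pos_of_pos (by norm_num : (0 : ℝ) < 1 / 4)
  positivity

/-- `ϖ₀² = Γ(1/4)⁴/(8π)`. [folklore] -/
theorem varpi_sq : ϖ₀ ^ 2 = Real.Gamma (1 / 4) ^ 4 / (8 * π) := by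
  rw [div_pow, mul_pow, Real.sq_sqrt (by positivity)]
  ring

/-- `ϖ₀⁴ = Γ(1/4)⁸/(64π²)`. [folklore] -/
theorem varpi_pow_four : ϖ₀ ^ 4 = Real.Gamma (1 / 4) ^ 8 / (64 * π ^ 2) := by
  rw [show (4 : ℕ) = 2 * 2 from rfl, pow_mul, varpi_sq, div_pow]
  ring

/-- `((1/2 : ℝ) : ℂ) = 1/2`. [folklore] -/
private theorem ofReal_one_half : ((1 / 2 : ℝ) : ℂ) = 1 / 2 := by push_cast; ring

/-- `((1/4 : ℝ) : ℂ) = 1/4`. [folklore] -/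
private theorem ofReal_one_quarter : ((1 / 4 : ℝ) : ℂ) = 1 / 4 := by push_cast; ring

/-- **`e₁ = ℘(1/2) = ϖ₀²`** (real form). [folklore] -/
theorem weierstrassPRe_half_eq_varpi_sq : (Λᵢ).weierstrassPRe (1 / 2) = ϖ₀ ^ 2 := by
  rw [weierstrassPRe_half_eq, varpi_sq]

/-- **`℘(1/2) = ϖ₀²`** for `ℤi + ℤ`. [folklore] -/
theorem weierstrassP_half : ℘[Λᵢ] (1 / 2) = ((ϖ₀ ^ 2 : ℝ) : ℂ) := by
  rw [← weierstrassPRe_half_eq_varpi_sq, isReal.ofReal_weierstrassPRe, ofReal_one_half]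

/-- `re g₂ = 4ϖ₀⁴`. [folklore] -/
theorem g₂_re_eq_varpi : (Λᵢ).g₂.re = 4 * ϖ₀ ^ 4 := by
  rw [(weierstrassPRe_half_pos_and_g₂_re_eq isReal minRealPeriod_eq g₃_ofUpperHalfPlane_I
    g₂_re_pos).2, weierstrassPRe_half_eq_varpi_sq]
  ring

/-- **`g₂(ℤi + ℤ) = 4ϖ₀⁴`**. [folklore] -/
theorem g₂_eq_varpi : (Λᵢ).g₂ = ((4 * ϖ₀ ^ 4 : ℝ) : ℂ) := by
  rw [← g₂_re_eq_varpi, isReal.ofReal_g₂_re]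

/-- `g₂(ℤi + ℤ) = 4ϖ₀⁴`, cast on the atom `ϖ₀`. [folklore] -/
theorem g₂_eq_varpi' : (Λᵢ).g₂ = 4 * ((ϖ₀ : ℝ) : ℂ) ^ 4 := by
  rw [g₂_eq_varpi]; push_cast; ring

/-- `(√2)² = 2` in `ℂ`. [folklore] -/
private theorem sqrt_two_sq : ((Real.sqrt 2 : ℝ) : ℂ) ^ 2 = 2 := by
  rw [← Complex.ofReal_pow, Real.sq_sqrt (by norm_num)]; push_cast; ring

/-! ### Quarter-period values: `℘(1/4) = (1 + √2)ϖ₀²`, `℘'(1/4) = −2√2(1 + √2)ϖ₀³` -/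

/-- `1/4` is not a lattice point, real-cast form. [folklore] -/
theorem ofReal_one_quarter_notMem : ((1 / 4 : ℝ) : ℂ) ∉ (Λᵢ).lattice := by
  rw [ofReal_one_quarter]; exact one_quarter_notMem

/-- `℘'(1/4) < 0` (real form: `℘` decreases on `(0, 1/2)`). [folklore] -/
theorem derivWeierstrassPRe_quarter_neg : (Λᵢ).derivWeierstrassPRe (1 / 4) < 0 :=
  isReal.derivWeierstrassPRe_neg (by norm_num) (by rw [minRealPeriod_eq]; norm_num)

/-- `℘(1/4) > ℘(1/2)` (real form). [folklore] -/
theorem weierstrassPRe_half_lt_quarter :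
    (Λᵢ).weierstrassPRe (1 / 2) < (Λᵢ).weierstrassPRe (1 / 4) := by
  have h := isReal.strictAntiOn_weierstrassPRe (L := Λᵢ)
  rw [minRealPeriod_eq] at h
  exact h ⟨by norm_num, by norm_num⟩ ⟨by norm_num, by norm_num⟩ (by norm_num)

/-- **`℘(1/4) = (1 + √2) e₁`** (real form). From the duplication formula
`℘(1/2) = ¼(℘''(1/4)/℘'(1/4))² − 2℘(1/4)` with `℘'' = 6℘² − g₂/2`, `℘'² = 4℘³ − g₂℘`,
`g₂ = 4e₁²`: writing `p = ℘(1/4)`, `e = e₁`, one gets `(p² − 2ep − e²)² = 0`, and `p > e > 0`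
selects `p = (1 + √2)e`. [folklore] -/
theorem weierstrassPRe_quarter : (Λᵢ).weierstrassPRe (1 / 4) = (1 + Real.sqrt 2) * ϖ₀ ^ 2 := by
  set e := (Λᵢ).weierstrassPRe (1 / 2) with he_def
  set p := (Λᵢ).weierstrassPRe (1 / 4) with hp_def
  set q := (Λᵢ).derivWeierstrassPRe (1 / 4) with hq_def
  have he : e = ϖ₀ ^ 2 := weierstrassPRe_half_eq_varpi_sq
  have hepos : 0 < e := he ▸ pow_pos varpi_pos 2
  have hpe : e < p := weierstrassPRe_half_lt_quarter
  have hq : q < 0 := derivWeierstrassPRe_quarter_neg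
  -- the differential equation at `1/4`
  have hode : q ^ 2 = 4 * p ^ 3 - 4 * e ^ 2 * p := by
    have h := isReal.derivWeierstrassPRe_sq (L := Λᵢ) ofReal_one_quarter_notMem
    rw [g₂_re_eq_varpi, g₃_ofUpperHalfPlane_I, Complex.zero_re, sub_zero] at h
    rw [h, he]; ring
  -- the duplication formula at `1/4`, in real form
  have hg₂ : (Λᵢ).g₂.re = 4 * e ^ 2 :=
    (weierstrassPRe_half_pos_and_g₂_re_eq isReal minRealPeriod_eq g₃_ofUpperHalfPlane_I
      g₂_re_pos).2
  have hdup : e = ((6 * p ^ 2 - 4 * e ^ 2 / 2) / q) ^ 2 / 4 - 2 * p := by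
    have hq0 : ℘'[Λᵢ] ((1 / 4 : ℝ) : ℂ) ≠ 0 := by
      rw [← isReal.ofReal_derivWeierstrassPRe]; exact_mod_cast hq.ne
    have h := weierstrassP_two_mul_holds (L := Λᵢ) _ ofReal_one_quarter_notMem hq0
    rw [deriv_derivWeierstrassP _ ofReal_one_quarter_notMem,
      show (2 : ℂ) * ((1 / 4 : ℝ) : ℂ) = ((1 / 2 : ℝ) : ℂ) by push_cast; ring,
      ← isReal.ofReal_weierstrassPRe, ← isReal.ofReal_weierstrassPRe,
      ← isReal.ofReal_derivWeierstrassPRe, ← isReal.ofReal_g₂_re, hg₂] at h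
    exact_mod_cast h
  have h4 : (6 * p ^ 2 - 4 * e ^ 2 / 2) ^ 2 = 4 * q ^ 2 * (e + 2 * p) := by
    have h1 : ((6 * p ^ 2 - 4 * e ^ 2 / 2) / q) ^ 2 / 4 = e + 2 * p := by linarith
    rw [div_pow, div_div, div_eq_iff (mul_ne_zero (pow_ne_zero 2 hq.ne) four_ne_zero)] at h1
    linarith
  have key : (p ^ 2 - 2 * e * p - e ^ 2) ^ 2 = 0 := by
    linear_combination (1 / 4 : ℝ) * h4 + (e + 2 * p) * hode
  have key' : (p - e) ^ 2 = (Real.sqrt 2 * e) ^ 2 := by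
    rw [mul_pow, Real.sq_sqrt (by norm_num)]
    have := pow_eq_zero_iff (n := 2) two_ne_zero |>.mp key
    nlinarith [this]
  have hpe' : p - e = Real.sqrt 2 * e :=
    (pow_left_inj₀ (by linarith) (by positivity) two_ne_zero).mp key'
  rw [← he]; linarith

/-- **`℘(1/4) = (1 + √2)ϖ₀²`** for `ℤi + ℤ`. [folklore] -/
theorem weierstrassP_quarter :
    ℘[Λᵢ] (1 / 4) = (1 + (Real.sqrt 2 : ℂ)) * ((ϖ₀ : ℝ) : ℂ) ^ 2 := by
  rw [← ofReal_one_quarter, ← isReal.ofReal_weierstrassPRe, weierstrassPRe_quarter]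
  push_cast; ring

/-- **`℘'(1/4) = −2√2(1 + √2) e₁^{3/2} = −2√2(1 + √2)ϖ₀³`** (real form): `℘'(1/4)² =
4p³ − 4e²p = 8(1 + √2)²e³` and `℘'(1/4) < 0`. [folklore] -/
theorem derivWeierstrassPRe_quarter :
    (Λᵢ).derivWeierstrassPRe (1 / 4) = -(2 * Real.sqrt 2 * (1 + Real.sqrt 2) * ϖ₀ ^ 3) := by
  set q := (Λᵢ).derivWeierstrassPRe (1 / 4) with hq_def
  set s := Real.sqrt 2 with hs_def
  have hs2 : s ^ 2 = 2 := Real.sq_sqrt (by norm_num)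
  have hs0 : 0 ≤ s := Real.sqrt_nonneg 2
  have hq : q < 0 := derivWeierstrassPRe_quarter_neg
  have hode : q ^ 2 = 4 * ((1 + s) * ϖ₀ ^ 2) ^ 3 - 4 * (ϖ₀ ^ 2) ^ 2 * ((1 + s) * ϖ₀ ^ 2) := by
    have h := isReal.derivWeierstrassPRe_sq (L := Λᵢ) ofReal_one_quarter_notMem
    rw [g₂_re_eq_varpi, g₃_ofUpperHalfPlane_I, Complex.zero_re, sub_zero,
      weierstrassPRe_quarter] at h
    rw [h]; ring
  have hsq : q ^ 2 = (2 * s * (1 + s) * ϖ₀ ^ 3) ^ 2 := by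
    linear_combination hode - 4 * (1 + s) * s * ϖ₀ ^ 6 * hs2
  have hpos : 0 ≤ 2 * s * (1 + s) * ϖ₀ ^ 3 := by
    have := varpi_pos; positivity
  have : -q = 2 * s * (1 + s) * ϖ₀ ^ 3 :=
    (pow_left_inj₀ (by linarith) hpos two_ne_zero).mp (by rw [neg_sq, hsq])
  linarith

/-- **`℘'(1/4) = −2√2(1 + √2)ϖ₀³`** for `ℤi + ℤ`. [folklore] -/
theorem derivWeierstrassP_quarter :
    ℘'[Λᵢ] (1 / 4) = -(2 * (Real.sqrt 2 : ℂ) * (1 + (Real.sqrt 2 : ℂ)) * ((ϖ₀ : ℝ) : ℂ) ^ 3) := by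
  rw [← ofReal_one_quarter, ← isReal.ofReal_derivWeierstrassPRe, derivWeierstrassPRe_quarter]
  push_cast; ring

/-- `℘(1/4) ≠ 0`. [folklore] -/
theorem weierstrassP_quarter_ne_zero : ℘[Λᵢ] (1 / 4) ≠ 0 := by
  rw [weierstrassP_quarter]
  have h1 : (0 : ℝ) < 1 + Real.sqrt 2 := by positivity
  have h2 := varpi_pos
  have : ((1 + Real.sqrt 2 : ℝ) : ℂ) * ((ϖ₀ : ℝ) : ℂ) ^ 2 ≠ 0 := by
    rw [← Complex.ofReal_pow, ← Complex.ofReal_mul, Complex.ofReal_ne_zero]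
    positivity
  simpa using this

/-- `℘'(1/4) ≠ 0`. [folklore] -/
theorem derivWeierstrassP_quarter_ne_zero : ℘'[Λᵢ] (1 / 4) ≠ 0 := by
  rw [← ofReal_one_quarter, ← isReal.ofReal_derivWeierstrassPRe, Complex.ofReal_ne_zero]
  exact derivWeierstrassPRe_quarter_neg.ne

/-- `℘''(1/4)/℘'(1/4) = −2(1 + √2)ϖ₀` (with `℘'' = 6℘² − g₂/2`). [folklore] -/
theorem deriv_derivWeierstrassP_quarter_div :
    deriv ℘'[Λᵢ] (1 / 4) / ℘'[Λᵢ] (1 / 4) = -(2 * (1 + (Real.sqrt 2 : ℂ)) * ((ϖ₀ : ℝ) : ℂ)) := by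
  rw [div_eq_iff derivWeierstrassP_quarter_ne_zero, deriv_derivWeierstrassP _ one_quarter_notMem,
    weierstrassP_quarter, derivWeierstrassP_quarter, g₂_eq_varpi']
  linear_combination ((ϖ₀ : ℝ) : ℂ) ^ 4 * (-2 - 4 * (Real.sqrt 2 : ℂ)) * sqrt_two_sq

/-! ### `ζ(1/4)`, and the points `(3+2i)/4 = 1/4 + (1+i)/2` -/

/-- **`ζ(1/4) = π/4 + (1 + √2)ϖ₀/2`** for `ℤi + ℤ`: the duplication formula
`ζ(1/2) = 2ζ(1/4) + ½℘''(1/4)/℘'(1/4)` with `ζ(1/2) = π/2` and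
`℘''(1/4)/℘'(1/4) = −2(1 + √2)ϖ₀`. [folklore] -/
theorem weierstrassZeta_quarter :
    (Λᵢ).weierstrassZeta (1 / 4) = π / 4 + (1 + (Real.sqrt 2 : ℂ)) * ((ϖ₀ : ℝ) : ℂ) / 2 := by
  have h := weierstrassZeta_two_mul (L := Λᵢ) one_quarter_notMem derivWeierstrassP_quarter_ne_zero
  rw [show (2 : ℂ) * (1 / 4) = 1 / 2 by norm_num, weierstrassZeta_half,
    deriv_derivWeierstrassP_quarter_div] at h
  linear_combination (-1 / 2 : ℂ) * h

/-- **`ζ((3+2i)/4) = 3π/4 − πi/2 + (1 − √2)ϖ₀/2`** for `ℤi + ℤ`: the addition theorem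
`ζ(u + v) = ζ(u) + ζ(v) + ½(℘'(u) − ℘'(v))/(℘(u) − ℘(v))` at `u = 1/4`, `v = (1+i)/2`
(`℘(v) = ℘'(v) = 0`, `ζ(v) = π(1−i)/2`, `℘'(1/4)/℘(1/4) = −2√2 ϖ₀`). [folklore] -/
theorem weierstrassZeta_three_add_two_I_quarter :
    (Λᵢ).weierstrassZeta ((3 + 2 * I) / 4) =
      3 * π / 4 - π * I / 2 + (1 - (Real.sqrt 2 : ℂ)) * ((ϖ₀ : ℝ) : ℂ) / 2 := by
  set s : ℂ := (Real.sqrt 2 : ℂ) with hs_def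
  set w : ℂ := ((ϖ₀ : ℝ) : ℂ) with hw_def
  have hs2 : s ^ 2 = 2 := by
    rw [hs_def, ← Complex.ofReal_pow, Real.sq_sqrt (by norm_num)]; push_cast; ring
  have hw0 : w ≠ 0 := by rw [hw_def]; exact Complex.ofReal_ne_zero.mpr varpi_pos.ne'
  have hs1 : 1 + s ≠ 0 := by
    rw [hs_def, ← Complex.ofReal_one, ← Complex.ofReal_add, Complex.ofReal_ne_zero]; positivity
  have hne : ℘[Λᵢ] (1 / 4) ≠ ℘[Λᵢ] ((1 + I) / 2) := by
    rw [weierstrassP_one_add_I_half]; exact weierstrassP_quarter_ne_zero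
  have h := weierstrassZeta_add_holds (L := Λᵢ) _ _ one_quarter_notMem one_add_I_half_notMem hne
  rw [show (1 / 4 : ℂ) + (1 + I) / 2 = (3 + 2 * I) / 4 by ring, weierstrassP_one_add_I_half,
    derivWeierstrassP_one_add_I_half, weierstrassZeta_quarter, weierstrassZeta_one_add_I_half,
    weierstrassP_quarter, derivWeierstrassP_quarter, sub_zero, sub_zero] at h
  rw [h, ← hs_def, ← hw_def]
  field_simp
  ring

/-- **`℘((3+2i)/4) = (1 − √2)ϖ₀²`** for `ℤi + ℤ` (addition theorem at `1/4 + (1+i)/2`: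
`¼(℘'(1/4)/℘(1/4))² − ℘(1/4) = 2ϖ₀² − (1 + √2)ϖ₀²`). [folklore] -/
theorem weierstrassP_three_add_two_I_quarter :
    ℘[Λᵢ] ((3 + 2 * I) / 4) = (1 - (Real.sqrt 2 : ℂ)) * ((ϖ₀ : ℝ) : ℂ) ^ 2 := by
  set s : ℂ := (Real.sqrt 2 : ℂ) with hs_def
  set w : ℂ := ((ϖ₀ : ℝ) : ℂ) with hw_def
  have hs2 : s ^ 2 = 2 := by
    rw [hs_def, ← Complex.ofReal_pow, Real.sq_sqrt (by norm_num)]; push_cast; ring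
  have hw0 : w ≠ 0 := by rw [hw_def]; exact Complex.ofReal_ne_zero.mpr varpi_pos.ne'
  have hs1 : 1 + s ≠ 0 := by
    rw [hs_def, ← Complex.ofReal_one, ← Complex.ofReal_add, Complex.ofReal_ne_zero]; positivity
  have hne : ℘[Λᵢ] (1 / 4) ≠ ℘[Λᵢ] ((1 + I) / 2) := by
    rw [weierstrassP_one_add_I_half]; exact weierstrassP_quarter_ne_zero
  have h := weierstrassP_add_holds (L := Λᵢ) _ _ one_quarter_notMem one_add_I_half_notMem hne
  rw [show (1 / 4 : ℂ) + (1 + I) / 2 = (3 + 2 * I) / 4 by ring, weierstrassP_one_add_I_half,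
    derivWeierstrassP_one_add_I_half, weierstrassP_quarter, derivWeierstrassP_quarter, sub_zero,
    sub_zero, sub_zero] at h
  rw [h, ← hs_def, ← hw_def]
  field_simp
  linear_combination (4 : ℂ) * hs2

/-! ### The Eisenstein–Kronecker function `E₁*(z) = ζ(z) − π z̄` of `ℤi + ℤ` -/

/-- The **Eisenstein–Kronecker function of weight one** of the Gaussian lattice `Λ = ℤi + ℤ`:
`E₁*(z) = ζ_Λ(z) − π z̄`. For a general lattice Kronecker's `Λ`-periodic (non-holomorphic)
completion of `ζ` is `ζ(z) − η(z)` with `η` the `ℝ`-linear quasi-period map; for `ℤi + ℤ`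
(`η(1) = π`, `η(i) = −πi`, covolume `1`) this is `ζ(z) − π z̄`. It is the value at `s = 0` of
Hecke's regularised series `Σ_λ (z + λ)⁻¹ |z + λ|^{-2s}`, equivalently (to be proved in the
companion file `GaussianKroneckerLimit`, in preparation) the limit of the Gaussian-regularised sums
`Σ_λ e^{−ε|z−λ|²}/(z − λ)` as `ε → 0⁺` (Kronecker's first limit formula in weight one;
A. Weil, *Elliptic functions according to Eisenstein and Kronecker* (1976), Ch. VIII §§2–6). Its
values at division points are the elliptic analogues of `cot(πa/N)` entering the finite
formulae of Birch–Swinnerton-Dyer (1965) for `L(E_D, 1)`. [folklore] -/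
def kroneckerE₁ (z : ℂ) : ℂ := (Λᵢ).weierstrassZeta z - π * (starRingEnd ℂ) z

/-- Unfolding lemma for `kroneckerE₁`. [folklore] -/
theorem kroneckerE₁_def (z : ℂ) :
    kroneckerE₁ z = (Λᵢ).weierstrassZeta z - π * (starRingEnd ℂ) z := rfl

/-- `E₁*` is odd. [folklore] -/
theorem kroneckerE₁_neg (z : ℂ) : kroneckerE₁ (-z) = -kroneckerE₁ z := by
  rw [kroneckerE₁_def, kroneckerE₁_def, weierstrassZeta_neg, map_neg]; ring

/-- **`E₁*(iz) = −i E₁*(z)`** (homogeneity of degree `−1` under the unit group of `ℤ[i]`).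
[folklore] -/
theorem kroneckerE₁_I_mul (z : ℂ) : kroneckerE₁ (I * z) = -I * kroneckerE₁ z := by
  rw [kroneckerE₁_def, kroneckerE₁_def, weierstrassZeta_I_mul, map_mul, Complex.conj_I]; ring

/-- `E₁*(z + 1) = E₁*(z)`. [folklore] -/
theorem kroneckerE₁_add_one (z : ℂ) : kroneckerE₁ (z + 1) = kroneckerE₁ z := by
  rw [kroneckerE₁_def, kroneckerE₁_def, weierstrassZeta_add_one, map_add, map_one]; ring

/-- `E₁*(z + i) = E₁*(z)`. [folklore] -/
theorem kroneckerE₁_add_I (z : ℂ) : kroneckerE₁ (z + I) = kroneckerE₁ z := by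
  rw [kroneckerE₁_def, kroneckerE₁_def, weierstrassZeta_add_I, map_add, Complex.conj_I]; ring

/-- `η₁ = 2ζ(i/2) = −πi` for the period `ω₁ = i`. [folklore] -/
theorem η₁_eq : (Λᵢ).η₁ = -(π * I) := by
  rw [PeriodPair.η₁, ofUpperHalfPlane_ω₁, UpperHalfPlane.coe_I, weierstrassZeta_I_half]; ring

/-- `η₂ = 2ζ(1/2) = π` for the period `ω₂ = 1`. [folklore] -/
theorem η₂_eq : (Λᵢ).η₂ = π := by
  rw [PeriodPair.η₂, ofUpperHalfPlane_ω₂, weierstrassZeta_half]; ring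

/-- **`E₁*` is `Λ`-periodic**: `E₁*(z + λ) = E₁*(z)` for `λ ∈ ℤi + ℤ` (the quasi-periods
`mη₁ + nη₂ = π(n − mi) = π · conj(mi + n)` cancel). [folklore] -/
theorem kroneckerE₁_add_of_mem (z : ℂ) {l : ℂ} (hl : l ∈ (Λᵢ).lattice) :
    kroneckerE₁ (z + l) = kroneckerE₁ z := by
  obtain ⟨m, n, rfl⟩ := mem_lattice_iff.mp hl
  have h := (Λᵢ).weierstrassZeta_add_period m n z
  rw [ofUpperHalfPlane_ω₁, ofUpperHalfPlane_ω₂, UpperHalfPlane.coe_I, η₁_eq, η₂_eq, mul_one] at h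
  rw [kroneckerE₁_def, kroneckerE₁_def, h, map_add, map_add, map_mul, Complex.conj_I,
    map_intCast, map_intCast]
  ring

/-! ### The two Eisenstein–Kronecker numbers at the primary quarter classes -/

/-- **`E₁*(1/4) = ζ(1/4) − π/4 = (1 + √2)ϖ₀/2`**. [folklore] -/
theorem kroneckerE₁_quarter :
    kroneckerE₁ (1 / 4) = (1 + (Real.sqrt 2 : ℂ)) * ((ϖ₀ : ℝ) : ℂ) / 2 := by
  rw [kroneckerE₁_def, weierstrassZeta_quarter, map_div₀, map_one]
  simp only [map_ofNat]
  ring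

/-- **`E₁*((3+2i)/4) = ζ((3+2i)/4) − π(3−2i)/4 = (1 − √2)ϖ₀/2`**. [folklore] -/
theorem kroneckerE₁_three_add_two_I_quarter :
    kroneckerE₁ ((3 + 2 * I) / 4) = (1 - (Real.sqrt 2 : ℂ)) * ((ϖ₀ : ℝ) : ℂ) / 2 := by
  rw [kroneckerE₁_def, weierstrassZeta_three_add_two_I_quarter, map_div₀, map_add, map_mul,
    Complex.conj_I]
  simp only [map_ofNat]
  ring

/-- **The two sums used for `L(E₁, 1)` and `L(E₂, 1)`**:
`E₁*(1/4) + E₁*((3+2i)/4) = ϖ₀` and `E₁*(1/4) − E₁*((3+2i)/4) = √2 ϖ₀`. [folklore] -/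
theorem kroneckerE₁_quarter_add_sub :
    kroneckerE₁ (1 / 4) + kroneckerE₁ ((3 + 2 * I) / 4) = ((ϖ₀ : ℝ) : ℂ) ∧
      kroneckerE₁ (1 / 4) - kroneckerE₁ ((3 + 2 * I) / 4) =
        (Real.sqrt 2 : ℂ) * ((ϖ₀ : ℝ) : ℂ) := by
  rw [kroneckerE₁_quarter, kroneckerE₁_three_add_two_I_quarter]
  constructor <;> ring

end GaussianLattice

end Literature.NumberTheory.EllipticCurves

end
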